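import Literature.RingTheory.CompleteLocalRings.CoefficientFieldSquareZero
import Mathlib.RingTheory.AdicCompletion.RingHom
import Mathlib.RingTheory.LocalRing.ResidueField.Defs
import Mathlib.RingTheory.LocalRing.RingHom.Basic
import Mathlib.Algebra.Algebra.ZMod
import Mathlib.Algebra.Field.ZMod
import HarnessLib

/-!
# Coefficient fields of complete equicharacteristic local rings (Cohen; Matsumura Thm. 28.3 (ii))

Topic: `Literature/RingTheory/CompleteLocalRings`. Let `(A, 𝔪, K)` be a local ring containing a
field (an *equicharacteristic* local ring) which is `𝔪`-adically complete
(`IsAdicComplete (maximalIdeal A) A`). I. S. Cohen's theorem (Matsumura, *Commutative Ring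
Theory*, Thm. 28.3 (ii): "if `A` is complete, it has a coefficient field") says that `A` contains
a subfield mapping isomorphically onto `K` under `A → A/𝔪 = K`, equivalently that the residue
map `A → K` admits a ring-homomorphism section `K → A`. We PROVE it:

* `exists_ringHom_comp_residue_eq_id` — for a field `k` and a complete local `k`-algebra `A`:
  `∃ σ : ResidueField A →+* A, ∀ x, residue A (σ x) = x`;
* `exists_ringHom_comp_residue_eq_id_of_subring` — the same with the field given as a subring
  `k₀ ⊆ A` with `IsField k₀` ("`A` contains a field");
* `exists_coefficientField` — a coefficient field as a subring `K' ⊆ A`: `K'` is a field and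
  `K' → A → K` is bijective (Matsumura's definition, §28 p. 215).

The proof is NOT the printed one (Matsumura deduces (ii) from the existence of a
quasi-coefficient field, Thm. 28.3 (i), via `p`-bases / differential bases (Thm. 26.8) and the
`0`-étale lifting (iv)). Instead we iterate the square-zero case already in the tree
(`exists_ringHom_section_of_sq_eq_bot`, file `CoefficientFieldSquareZero.lean`, Cohen's own
argument): given a ring homomorphism `σₙ : K → A/𝔪ⁿ⁺¹`, let `B ⊆ A/𝔪ⁿ⁺²` be the preimage of
`σₙ(K)` under `π : A/𝔪ⁿ⁺² → A/𝔪ⁿ⁺¹` and `J = B ∩ ker π`; then `J² = 0`, `B/J ≅ K` is a field,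
and `B` is an algebra over the prime field `F` (`= ℚ` or `𝔽ₚ`; ring homomorphisms out of `F`
are unique, which is all that is used of it), so the square-zero case gives a section
`B/J → B`, i.e. a lift `σₙ₊₁ : K → A/𝔪ⁿ⁺²` of `σₙ` (`exists_ringHom_lift_succ`). Starting from
`σ₀ = id`, the universal property of the `𝔪`-adically complete ring `A`
(`IsAdicComplete.StrictMono.liftRingHom`) assembles the `σₙ` into the section `K → A`.
No Noetherian hypothesis is needed.

## Sources

* H. Matsumura, *Commutative Ring Theory*, CUP 1986, §28, p. 215 [PDF 232]: definition of
  coefficient field ("`K'` maps isomorphically to `K` under the natural map `A → A/𝔪 = K`, or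
  equivalently, `A = K' + 𝔪`") and Thm. 28.3 (ii). [Matsumura1987]
* I. S. Cohen, *On the structure and ideal theory of complete local rings*, Trans. AMS 59
  (1946), Thm. 9.

What is NOT here: uniqueness statements, quasi-coefficient fields (Thm. 28.3 (i), (iii), (iv)),
coefficient rings in unequal characteristic (§29).
-/

noncomputable section

namespace Literature.RingTheory.CompleteLocalRings

universe u v

open IsLocalRing

/-! ## One lifting step: from `A/𝔪ⁿ⁺¹` to `A/𝔪ⁿ⁺²` -/

section Step

variable {F : Type v} [Field F]
  (hF : ∀ (R : Type u) [Semiring R] (f g : F →+* R), f = g)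
  {A : Type u} [CommRing A] [IsLocalRing A] [Algebra F A]

include hF in
/-- **The lifting step.** Let `(A, 𝔪, K)` be a local ring which is an algebra over a field `F`
out of which ring homomorphisms are unique (a prime field). Every ring homomorphism
`σ : K → A/𝔪ⁿ⁺¹` lifts along `π : A/𝔪ⁿ⁺² → A/𝔪ⁿ⁺¹` to a ring homomorphism `σ' : K → A/𝔪ⁿ⁺²`.
Proof: `B = π⁻¹(σ K)` is an `F`-subalgebra of `A/𝔪ⁿ⁺²`, `ψ : B → K` (`π` followed by `σ⁻¹`) is
onto with kernel `J`, `J² = 0` because `ker π = 𝔪ⁿ⁺¹/𝔪ⁿ⁺²`; the square-zero case of Cohen's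
theorem (`exists_ringHom_section_of_sq_eq_bot`) gives a section `τ` of `B → B/J ≅ K`, and
`σ' = τ ∘ (B/J ≅ K)⁻¹`. [cite: Matsumura1987, Thm. 28.3 (ii)] -/
theorem exists_ringHom_lift_succ (n : ℕ)
    (σ : ResidueField A →+* A ⧸ maximalIdeal A ^ (n + 1)) :
    ∃ σ' : ResidueField A →+* A ⧸ maximalIdeal A ^ (n + 2),
      (Ideal.Quotient.factorPowSucc (maximalIdeal A) (n + 1)).comp σ' = σ := by
  classical
  have hmpow : ∀ k : ℕ, maximalIdeal A ^ (k + 1) ≠ ⊤ := fun k h =>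
    (maximalIdeal.isMaximal A).ne_top (top_le_iff.mp (h ▸ Ideal.pow_le_self k.succ_ne_zero))
  haveI : Nontrivial (A ⧸ maximalIdeal A ^ (n + 1)) :=
    Ideal.Quotient.nontrivial_iff.mpr (hmpow n)
  -- `π : A/𝔪ⁿ⁺² → A/𝔪ⁿ⁺¹`
  let π : A ⧸ maximalIdeal A ^ (n + 2) →+* A ⧸ maximalIdeal A ^ (n + 1) :=
    Ideal.Quotient.factorPowSucc (maximalIdeal A) (n + 1)
  have hπsurj : Function.Surjective π := Ideal.Quotient.factor_surjective _
  have hπker : RingHom.ker π =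
      (maximalIdeal A ^ (n + 1)).map (Ideal.Quotient.mk (maximalIdeal A ^ (n + 2))) :=
    Ideal.Quotient.factor_ker _
  have hσ : Function.Injective σ := σ.injective
  -- `K ≅ σ(K)`
  let eσ : ResidueField A ≃+* σ.range :=
    RingEquiv.ofBijective σ.rangeRestrict
      ⟨fun x y h => hσ (congrArg Subtype.val h), σ.rangeRestrict_surjective⟩
  have heσ_apply : ∀ x, ((eσ x : σ.range) : A ⧸ maximalIdeal A ^ (n + 1)) = σ x := fun x => rfl
  -- `B = π⁻¹(σ K)`, an `F`-subalgebra of `A/𝔪ⁿ⁺²`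
  have halg : ∀ c : F, π (algebraMap F (A ⧸ maximalIdeal A ^ (n + 2)) c) ∈ σ.range := fun c =>
    ⟨algebraMap F (ResidueField A) c, by
      have h := hF (A ⧸ maximalIdeal A ^ (n + 1)) (σ.comp (algebraMap F (ResidueField A)))
        (π.comp (algebraMap F (A ⧸ maximalIdeal A ^ (n + 2))))
      exact congrArg (fun φ : F →+* A ⧸ maximalIdeal A ^ (n + 1) => φ c) h⟩
  let B : Subalgebra F (A ⧸ maximalIdeal A ^ (n + 2)) :=
    { toSubsemiring := (σ.range.comap π).toSubsemiring
      algebraMap_mem' := halg }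
  have hmemB : ∀ r : A ⧸ maximalIdeal A ^ (n + 2), r ∈ B ↔ π r ∈ σ.range := fun r => Iff.rfl
  -- `ψ : B → K`, `π` followed by `σ⁻¹`
  let θ : B →+* σ.range := (π.comp (algebraMap B (A ⧸ maximalIdeal A ^ (n + 2)))).codRestrict
    σ.range (fun b => (hmemB b).mp b.2)
  have hθ_apply : ∀ b : B, ((θ b : σ.range) : A ⧸ maximalIdeal A ^ (n + 1)) = π (b : _) :=
    fun b => rfl
  let ψ : B →+* ResidueField A := eσ.symm.toRingHom.comp θ
  have hψ_spec : ∀ b : B, σ (ψ b) = π (b : A ⧸ maximalIdeal A ^ (n + 2)) := fun b => by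
    rw [← hθ_apply, ← heσ_apply]
    simp [ψ]
  have hψsurj : Function.Surjective ψ := fun k => by
    obtain ⟨r, hr⟩ := hπsurj (σ k)
    refine ⟨⟨r, (hmemB r).mpr ⟨k, hr.symm⟩⟩, hσ ?_⟩
    rw [hψ_spec, hr]
  -- `J = ker ψ` is maximal with `J² = 0`
  haveI hJmax : (RingHom.ker ψ).IsMaximal := RingHom.ker_isMaximal_of_surjective ψ hψsurj
  have hJker : ∀ b ∈ RingHom.ker ψ, (b : A ⧸ maximalIdeal A ^ (n + 2)) ∈
      (maximalIdeal A ^ (n + 1)).map (Ideal.Quotient.mk (maximalIdeal A ^ (n + 2))) := by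
    intro b hb
    have h1 : π (b : _) = 0 := by
      rw [← hψ_spec, RingHom.mem_ker.mp hb, map_zero]
    have h2 : (b : A ⧸ maximalIdeal A ^ (n + 2)) ∈ RingHom.ker π := h1
    rwa [hπker] at h2
  have hJ2 : RingHom.ker ψ ^ 2 = ⊥ := by
    rw [pow_two, ← le_bot_iff, Ideal.mul_le]
    intro b hb b' hb'
    rw [Ideal.mem_bot, ← Subtype.coe_inj, Subalgebra.coe_mul, Subalgebra.coe_zero]
    have hprod : (b : A ⧸ maximalIdeal A ^ (n + 2)) * (b' : _) ∈
        ((maximalIdeal A ^ (n + 1)).map (Ideal.Quotient.mk (maximalIdeal A ^ (n + 2)))) *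
          ((maximalIdeal A ^ (n + 1)).map (Ideal.Quotient.mk (maximalIdeal A ^ (n + 2)))) :=
      Ideal.mul_mem_mul (hJker b hb) (hJker b' hb')
    rw [← Ideal.map_mul, ← pow_add] at hprod
    have hle : (maximalIdeal A ^ (n + 1 + (n + 1))).map
        (Ideal.Quotient.mk (maximalIdeal A ^ (n + 2))) = ⊥ := by
      rw [← le_bot_iff, ← Ideal.map_quotient_self (maximalIdeal A ^ (n + 2))]
      exact Ideal.map_mono (Ideal.pow_le_pow_right (by omega))
    rw [hle, Ideal.mem_bot] at hprod
    exact hprod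
  -- the square-zero case of Cohen's theorem, for the `F`-algebra `B`
  obtain ⟨τ, hτ⟩ := exists_ringHom_section_of_sq_eq_bot F (RingHom.ker ψ) hJ2
  let e : B ⧸ RingHom.ker ψ ≃+* ResidueField A := RingHom.quotientKerEquivOfSurjective hψsurj
  refine ⟨(algebraMap B (A ⧸ maximalIdeal A ^ (n + 2))).comp (τ.comp e.symm.toRingHom),
    RingHom.ext fun k => ?_⟩
  have hk : ψ (τ (e.symm k)) = k := by
    rw [← RingHom.quotientKerEquivOfSurjective_apply_mk hψsurj, hτ]
    exact RingEquiv.apply_symm_apply e k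
  calc (Ideal.Quotient.factorPowSucc (maximalIdeal A) (n + 1))
        ((algebraMap B (A ⧸ maximalIdeal A ^ (n + 2))) (τ (e.symm k)))
      = π ((τ (e.symm k) : B) : A ⧸ maximalIdeal A ^ (n + 2)) := rfl
    _ = σ (ψ (τ (e.symm k))) := (hψ_spec _).symm
    _ = σ k := by rw [hk]

end Step

/-! ## Passage to the limit over `A/𝔪ⁿ` -/

section Limit

variable {F : Type v} [Field F]
  (hF : ∀ (R : Type u) [Semiring R] (f g : F →+* R), f = g)
  (A : Type u) [CommRing A] [IsLocalRing A] [Algebra F A] [IsAdicComplete (maximalIdeal A) A]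

include hF in
/-- **Cohen's theorem over a prime field.** A local ring `(A, 𝔪, K)` which is `𝔪`-adically
complete and an algebra over a field `F` out of which ring homomorphisms are unique has a
coefficient field: the residue map `A → K` has a ring-homomorphism section. The compatible
lifts `σₙ : K → A/𝔪ⁿ⁺¹` of `σ₀ = id` (`exists_ringHom_lift_succ`) glue by the universal
property of the complete ring `A`. [cite: Matsumura1987, Thm. 28.3 (ii)] -/
theorem exists_ringHom_comp_residue_eq_id_of_primeField :
    ∃ σ : ResidueField A →+* A, ∀ x, residue A (σ x) = x := by
  -- `σ₀ : K = A/𝔪 → A/𝔪¹`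
  have h01 : ∀ a ∈ maximalIdeal A, Ideal.Quotient.mk (maximalIdeal A ^ (0 + 1)) a = 0 :=
    fun a ha => Ideal.Quotient.eq_zero_iff_mem.mpr (by rwa [zero_add, pow_one])
  let σ₀ : ResidueField A →+* A ⧸ maximalIdeal A ^ (0 + 1) :=
    Ideal.Quotient.lift (maximalIdeal A) (Ideal.Quotient.mk (maximalIdeal A ^ (0 + 1))) h01
  have hσ₀ : ∀ a : A, σ₀ (residue A a) = Ideal.Quotient.mk (maximalIdeal A ^ (0 + 1)) a :=
    fun a => Ideal.Quotient.lift_mk _ _ _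
  -- the compatible family `σₙ`
  choose g hg using fun (n : ℕ) (σ : ResidueField A →+* A ⧸ maximalIdeal A ^ (n + 1)) =>
    exists_ringHom_lift_succ hF n σ
  let f : (n : ℕ) → (ResidueField A →+* A ⧸ maximalIdeal A ^ (n + 1)) := fun n =>
    Nat.rec (motive := fun n => ResidueField A →+* A ⧸ maximalIdeal A ^ (n + 1)) σ₀
      (fun n σ => g n σ) n
  have hf0 : f 0 = σ₀ := rfl
  have hfsucc : ∀ n, (Ideal.Quotient.factorPowSucc (maximalIdeal A) (n + 1)).comp (f (n + 1)) =
      f n := fun n => hg n (f n)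
  have ha : StrictMono (fun n : ℕ => n + 1) := fun a b h => Nat.succ_lt_succ h
  have hf : ∀ {k : ℕ},
      (Ideal.Quotient.factorPow (maximalIdeal A) (ha.monotone k.le_succ)).comp (f (k + 1)) =
        f k := fun {k} => hfsucc k
  refine ⟨IsAdicComplete.StrictMono.liftRingHom (maximalIdeal A) ha f hf, fun x => ?_⟩
  obtain ⟨a, rfl⟩ := IsLocalRing.residue_surjective x
  have h1 : Ideal.Quotient.mk (maximalIdeal A ^ (0 + 1))
      (IsAdicComplete.StrictMono.liftRingHom (maximalIdeal A) ha f hf (residue A a)) =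
        f 0 (residue A a) :=
    IsAdicComplete.StrictMono.mk_liftRingHom (maximalIdeal A) ha f hf (residue A a)
  rw [hf0, hσ₀, Ideal.Quotient.eq, zero_add, pow_one] at h1
  exact (Ideal.Quotient.eq (I := maximalIdeal A)).mpr h1

end Limit

/-! ## Equicharacteristic complete local rings -/

section Main

variable (A : Type u) [CommRing A] [IsLocalRing A] [IsAdicComplete (maximalIdeal A) A]

/-- **Cohen's theorem on coefficient fields (Matsumura, Thm. 28.3 (ii)).** Let `(A, 𝔪, K)` be a
local ring which is `𝔪`-adically complete and contains a field, in the form: `A` is an algebra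
over a field `k`. Then `A` has a coefficient field: there is a ring homomorphism
`σ : K → A` with `residue ∘ σ = id`. (Printed: "(ii) if `A` is complete, it has a coefficient
field.") Reduction to the prime field `ℚ` or `𝔽ₚ` of `k`, then
`exists_ringHom_comp_residue_eq_id_of_primeField`. [cite: Matsumura1987, Thm. 28.3 (ii)] -/
theorem exists_ringHom_comp_residue_eq_id (k : Type v) [Field k] [Algebra k A] :
    ∃ σ : ResidueField A →+* A, ∀ x, residue A (σ x) = x := by
  obtain ⟨p, hp⟩ := CharP.exists k
  rcases CharP.char_is_prime_or_zero k p with hprime | rfl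
  · haveI : Fact p.Prime := ⟨hprime⟩
    haveI : CharP A p := charP_of_injective_algebraMap (algebraMap k A).injective p
    letI : Algebra (ZMod p) A := ZMod.algebra A p
    exact exists_ringHom_comp_residue_eq_id_of_primeField
      (F := ZMod p) (fun R _ f g => RingHom.ext_zmod f g) A
  · haveI : CharZero k := CharP.charP_to_charZero k
    letI : Algebra ℚ A := ((algebraMap k A).comp (algebraMap ℚ k)).toAlgebra
    exact exists_ringHom_comp_residue_eq_id_of_primeField
      (F := ℚ) (fun R _ f g => RingHom.ext_rat f g) A

/-- **Cohen's theorem on coefficient fields**, for a local ring containing a field given as a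
subring `k₀ ⊆ A` which is a field (Matsumura §28 p. 215: "`A` is said to be equicharacteristic
… this is equivalent to saying that `A` contains a field"): if `A` is `𝔪`-adically complete
then the residue map has a ring-homomorphism section. [cite: Matsumura1987, Thm. 28.3 (ii)] -/
theorem exists_ringHom_comp_residue_eq_id_of_subring (k₀ : Subring A) (hk₀ : IsField k₀) :
    ∃ σ : ResidueField A →+* A, ∀ x, residue A (σ x) = x := by
  letI : Field k₀ := hk₀.toField
  letI : Algebra k₀ A := k₀.subtype.toAlgebra
  exact exists_ringHom_comp_residue_eq_id A k₀

/-- The image of a section of the residue map is a **coefficient field** in Matsumura's sense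
(§28 p. 215: a subfield `K' ⊆ A` which "maps isomorphically to `K` under the natural map
`A → A/𝔪 = K`"). [cite: Matsumura1987, §28 p. 215] -/
theorem isField_range_of_comp_residue_eq_id {A : Type u} [CommRing A] [IsLocalRing A]
    (σ : ResidueField A →+* A) (hσ : ∀ x, residue A (σ x) = x) :
    IsField σ.range ∧ Function.Bijective ((residue A).domRestrict σ.range) := by
  have hinj : Function.Injective σ := fun x y h => by rw [← hσ x, ← hσ y, h]
  have hbij : Function.Bijective σ.rangeRestrict :=
    ⟨fun x y h => hinj (congrArg Subtype.val h), σ.rangeRestrict_surjective⟩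
  refine ⟨MulEquiv.isField (Field.toIsField (ResidueField A))
    (RingEquiv.ofBijective σ.rangeRestrict hbij).symm.toMulEquiv, ?_, ?_⟩
  · rintro ⟨_, x, rfl⟩ ⟨_, y, rfl⟩ h
    have h' : residue A (σ x) = residue A (σ y) := h
    rw [hσ, hσ] at h'
    exact Subtype.ext (congrArg σ h')
  · intro x
    exact ⟨⟨σ x, x, rfl⟩, hσ x⟩

/-- **Matsumura, Thm. 28.3 (ii), subring form.** A complete local ring containing a field has a
coefficient field: a subring `K' ⊆ A` which is a field and maps bijectively onto the residue
field under `A → A/𝔪`. [cite: Matsumura1987, Thm. 28.3 (ii)] -/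
theorem exists_coefficientField (k₀ : Subring A) (hk₀ : IsField k₀) :
    ∃ K' : Subring A, IsField K' ∧ Function.Bijective ((residue A).domRestrict K') := by
  obtain ⟨σ, hσ⟩ := exists_ringHom_comp_residue_eq_id_of_subring A k₀ hk₀
  exact ⟨σ.range, isField_range_of_comp_residue_eq_id σ hσ⟩

end Main

end Literature.RingTheory.CompleteLocalRings

end
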